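import Summits.CriticalPhenomena.Ising3DConformalLimit.Theorems.PerfectScreeningSubharmonicOffOriginJointSpecTorus
import Summits.CriticalPhenomena.Ising3DConformalLimit.Theorems.PerfectScreeningSubharmonicOffOriginJointSpecLimit
import Literature.Probability.LatticeModels.CriticalTwoPointBounds

/-!
# Crux `PerfectScreening.SubharmonicOffOrigin` (stmt-CriticalPhenomena-1341), line
`kl-band-positivity`: stub `stub_jointSpectralMeasure` (the JOINT SPECTRAL MEASURE)

This file proves the registered stub `stub_jointSpectralMeasure : Sig.stub_jointSpectralMeasure` of
the checked skeleton of the line `kl-band-positivity` (objects and signatures in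
`PerfectScreeningSubharmonicOffOriginKlBandDefs`): for every coordinate direction `i₀ : Fin 3` there
is a finite positive measure `ρ` on `ℝ × ℝ²` carried by the spectral window `(0,1] × ℝ²` (NO atom at
`λ = 0`) with `⟨σ₀σ_x⟩⁺_{β_c(3)} = ∫ λ^{|x_{i₀}|} cos(k·x̌) dρ(λ,k)` for ALL `x ∈ ℤ³` — the joint
spectral measure of the transfer matrix and of the transverse translations (Glimm–Jaffe, *Quantum
Physics* §6.1; Aizenman–Duminil-Copin 2021, Prop. 5.3 / App. Prop. 8.6, jointly in the transverse
momentum).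

Proof (the three parts):
* finite volume (helper 1, `jointSpec_torusSum`, module `…JointSpecTorus`): on the torus
  `(ℤ/Nℤ)³`, `N ≥ 3`, `⟨σ₀σ_{ins_{i₀}(n,u)}⟩_{𝕋_N;β} = ∑_{q,k,l} w_{qkl} (λ_l/λ_k)ⁿ Re χ_q(u)`,
  `0 ≤ n < N`, with `w ≥ 0` and the uniform no-atom bound `∑_{λ_l/λ_k ≤ δ} w ≤ Bδ²`; here
  (`jointSpec_torusMeasure`) this is packaged as the finitely supported positive measure
  `ν_N = ∑ w_{qkl} δ_{(λ_l/λ_k, 2πq/N)}` on `[0,∞) × [0,2π]²`, using that characters at projected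
  lattice points are momentum phases (`jointSpec_torusChar_proj_re`);
* the limit `N → ∞` (helper 2, `jointSpec_limit`, module `…JointSpecLimit`): at `β = β_c(3) > 0`
  (`criticalBeta_pos_holds`) the magnetisation vanishes (`spontaneousMagnetization_criticalBeta_eq_zero_holds`,
  ADS 2015), so the periodic two-point function converges to `⟨σ₀σ_x⟩⁺`
  (`tendsto_isingTorusTwoPoint_proj_of_magnetization_eq_zero`, ADC Prop. 5.2), and the weak-limit
  lemma yields `ρ` on `(0,1] × ℝ²` with the joint representation for `x_{i₀} ≥ 0`;
* `x_{i₀} < 0` by the reflection symmetry of the plus state (`twoPointPlus_reflection_invariant_holds`).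

References: J. Glimm, A. Jaffe, *Quantum Physics* (1987) §6.1; M. Aizenman, H. Duminil-Copin, Ann. of
Math. 194 (2021) = arXiv:1912.07973, Prop. 5.2, Prop. 5.3, App. Prop. 8.6.
-/

noncomputable section

open MeasureTheory ProbabilityTheory
open Literature.Probability.LatticeModels

namespace Summit.CriticalPhenomena.Ising3DConformalLimit.Theorems.PerfectScreening.KlBand

open Filter
open scoped Topology

/-- **Characters at projected lattice points are momentum phases**: for `y ∈ ℤ^{d'}`,
`Re χ_q(ȳ) = cos(∑ⱼ p_j y_j)` with `p = latticeMomentum N q = 2πq/N` (the reduction `ȳ = y mod N`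
shifts the phase by a multiple of `2π`). -/
theorem jointSpec_torusChar_proj_re {d' N : ℕ} [NeZero N] (q : TorusSite d' N) (y : Fin d' → ℤ) :
    (torusChar q (Torus.proj N y)).re = Real.cos (∑ j, latticeMomentum N q j * (y j : ℝ)) := by
  rw [torusChar_re]
  have hN : (N : ℝ) ≠ 0 := Nat.cast_ne_zero.2 (NeZero.ne N)
  have h : ∀ j, latticeMomentum N q j * (((Torus.proj N y) j).val : ℝ) =
      latticeMomentum N q j * (y j : ℝ) + ((-((q j).val * (y j / N)) : ℤ) : ℝ) * (2 * Real.pi) := by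
    intro j
    have hval : ((((y j : ℤ) : ZMod N)).val : ℤ) = y j % (N : ℤ) := ZMod.val_intCast (y j)
    rw [Int.emod_def] at hval
    have hval' : ((((y j : ℤ) : ZMod N)).val : ℝ) = (y j : ℝ) - (N : ℝ) * ((y j / N : ℤ) : ℝ) := by
      have := congrArg (fun z : ℤ => (z : ℝ)) hval
      push_cast at this
      exact_mod_cast this
    simp only [Torus.proj_apply, latticeMomentum]
    rw [hval']
    push_cast
    field_simp
    ring
  simp_rw [h]
  rw [Finset.sum_add_distrib, ← Finset.sum_mul, ← Int.cast_sum, Real.cos_add_int_mul_two_pi]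

/-- **The finite-volume joint spectral MEASURE** of the periodic two-point function in direction `i`:
for `β > 0`, on every torus `(ℤ/Nℤ)^{d'+1}`, `N ≥ 3`, a finitely supported positive measure `ν_N` on
`[0,∞) × [0,2π]^{d'}` (atoms `(λ_l/λ_k, 2πq/N)`, weights `w_{qkl}` of `jointSpec_torusSum`) with
`∫ λⁿ cos(k·y) dν_N = ⟨σ₀ σ_{ins_i(n, ȳ)}⟩_{𝕋_N;β}` for `0 ≤ n < N`, `y ∈ ℤ^{d'}`, and
`ν_N([0,δ] × ℝ^{d'}) ≤ B δ²` uniformly in `N`. -/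
theorem jointSpec_torusMeasure {β : ℝ} (hβ : 0 < β) (d' : ℕ) :
    ∃ B : ℝ, 0 ≤ B ∧ ∀ (N : ℕ) [NeZero N], 3 ≤ N → ∀ i : Fin (d' + 1),
      ∃ ν : Measure (ℝ × (Fin d' → ℝ)), IsFiniteMeasure ν ∧
        ν (Set.Ici (0 : ℝ) ×ˢ Set.Icc (0 : Fin d' → ℝ) (fun _ => 2 * Real.pi))ᶜ = 0 ∧
        (∀ g : ℝ × (Fin d' → ℝ) → ℝ, Integrable g ν) ∧
        (∀ n : ℕ, n < N → ∀ y : Fin d' → ℤ,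
          ∫ p, p.1 ^ n * Real.cos (∑ j, p.2 j * (y j : ℝ)) ∂ν =
            isingTorusTwoPoint (d' + 1) N β 0 0 (Torus.ins i (n : ZMod N) (Torus.proj N y))) ∧
        (∀ δ : ℝ, 0 ≤ δ → ν (Set.Icc 0 δ ×ˢ Set.univ) ≤ ENNReal.ofReal (B * δ ^ 2)) := by
  obtain ⟨B, hB0, hB⟩ := jointSpec_torusSum hβ d'
  refine ⟨B, hB0, fun N _ hN i => ?_⟩
  classical
  obtain ⟨ev, w, hev, hw, hrep, hatom⟩ := hB N hN i
  have hx0 : ∀ k l : Layer d' N, 0 ≤ ev l / ev k := fun k l => div_nonneg (hev l) (hev k)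
  have hP0 : ∀ q : TorusSite d' N, latticeMomentum N q ∈ Set.Icc (0 : Fin d' → ℝ) (fun _ => 2 * Real.pi) := by
    intro q
    have hNpos : (0 : ℝ) < N := by exact_mod_cast Nat.pos_of_ne_zero (NeZero.ne N)
    refine ⟨fun j => ?_, fun j => ?_⟩
    · simp only [latticeMomentum, Pi.zero_apply]
      positivity
    · simp only [latticeMomentum]
      have hval : ((q j).val : ℝ) ≤ N := by exact_mod_cast (ZMod.val_lt (q j)).le
      rw [div_le_iff₀ hNpos]
      nlinarith [Real.pi_pos]
  -- the atomic measure
  let ν : Measure (ℝ × (Fin d' → ℝ)) := ∑ t : TorusSite d' N × Layer d' N × Layer d' N,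
    ENNReal.ofReal (w t.1 t.2.1 t.2.2) • Measure.dirac (ev t.2.2 / ev t.2.1, latticeMomentum N t.1)
  have hνapply : ∀ s : Set (ℝ × (Fin d' → ℝ)), MeasurableSet s →
      ν s = ∑ t : TorusSite d' N × Layer d' N × Layer d' N, ENNReal.ofReal (w t.1 t.2.1 t.2.2) *
        s.indicator 1 (ev t.2.2 / ev t.2.1, latticeMomentum N t.1) := by
    intro s hs
    simp only [ν, Measure.coe_finsetSum, Finset.sum_apply, Measure.smul_apply, smul_eq_mul,
      Measure.dirac_apply' _ hs]
  have hintd : ∀ (g : ℝ × (Fin d' → ℝ) → ℝ) (a : ℝ × (Fin d' → ℝ)), Integrable g (Measure.dirac a) :=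
    fun g a => (integrable_const (g a)).congr (ae_eq_dirac g).symm
  have hint : ∀ g : ℝ × (Fin d' → ℝ) → ℝ, Integrable g ν := fun g =>
    integrable_finsetSum_measure.2 fun t _ => (hintd g _).smul_measure ENNReal.ofReal_ne_top
  have hintegral : ∀ g : ℝ × (Fin d' → ℝ) → ℝ, ∫ p, g p ∂ν =
      ∑ t : TorusSite d' N × Layer d' N × Layer d' N,
        w t.1 t.2.1 t.2.2 * g (ev t.2.2 / ev t.2.1, latticeMomentum N t.1) := by
    intro g
    rw [integral_finsetSum_measure fun t _ => (hintd g _).smul_measure ENNReal.ofReal_ne_top]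
    refine Finset.sum_congr rfl fun t _ => ?_
    rw [integral_smul_measure, integral_dirac, ENNReal.toReal_ofReal (hw _ _ _), smul_eq_mul]
  refine ⟨ν, ?_, ?_, hint, fun n hn y => ?_, fun δ hδ => ?_⟩
  · -- finite
    refine ⟨?_⟩
    rw [hνapply _ MeasurableSet.univ]
    exact ENNReal.sum_lt_top.2 fun t _ => ENNReal.mul_lt_top ENNReal.ofReal_lt_top (by simp)
  · -- carried by `[0,∞) × [0,2π]^{d'}`
    rw [hνapply _ (measurableSet_Ici.prod measurableSet_Icc).compl]
    refine Finset.sum_eq_zero fun t _ => ?_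
    have hmem : (ev t.2.2 / ev t.2.1, latticeMomentum N t.1) ∈
        Set.Ici (0 : ℝ) ×ˢ Set.Icc (0 : Fin d' → ℝ) (fun _ => 2 * Real.pi) :=
      Set.mk_mem_prod (Set.mem_Ici.2 (hx0 _ _)) (hP0 _)
    rw [Set.indicator_of_notMem (Set.notMem_compl_iff.2 hmem), mul_zero]
  · -- the joint test integrals, `0 ≤ n < N`
    rw [hintegral, hrep n hn, Fintype.sum_prod_type]
    refine Finset.sum_congr rfl fun q _ => ?_
    rw [Fintype.sum_prod_type]
    refine Finset.sum_congr rfl fun k _ => Finset.sum_congr rfl fun l _ => ?_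
    rw [jointSpec_torusChar_proj_re]
    ring
  · -- the uniform bound near `λ = 0`
    rw [hνapply _ (measurableSet_Icc.prod MeasurableSet.univ)]
    have hterm : ∀ t : TorusSite d' N × Layer d' N × Layer d' N,
        ENNReal.ofReal (w t.1 t.2.1 t.2.2) *
            (Set.Icc 0 δ ×ˢ (Set.univ : Set (Fin d' → ℝ))).indicator 1 (ev t.2.2 / ev t.2.1, latticeMomentum N t.1) =
          ENNReal.ofReal (if ev t.2.2 / ev t.2.1 ≤ δ then w t.1 t.2.1 t.2.2 else 0) := by
      intro t
      by_cases h : ev t.2.2 / ev t.2.1 ≤ δ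
      · have hmem : (ev t.2.2 / ev t.2.1, latticeMomentum N t.1) ∈ Set.Icc 0 δ ×ˢ (Set.univ : Set (Fin d' → ℝ)) :=
          Set.mk_mem_prod (Set.mem_Icc.2 ⟨hx0 _ _, h⟩) (Set.mem_univ _)
        rw [if_pos h, Set.indicator_of_mem hmem, Pi.one_apply, mul_one]
      · have hnm : (ev t.2.2 / ev t.2.1, latticeMomentum N t.1) ∉ Set.Icc 0 δ ×ˢ (Set.univ : Set (Fin d' → ℝ)) :=
          fun h' => h (Set.mem_prod.1 h').1.2
        rw [if_neg h, Set.indicator_of_notMem hnm, mul_zero, ENNReal.ofReal_zero]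
    have hnn : ∀ t : TorusSite d' N × Layer d' N × Layer d' N,
        0 ≤ (if ev t.2.2 / ev t.2.1 ≤ δ then w t.1 t.2.1 t.2.2 else 0) := fun t => by
      split_ifs
      · exact hw _ _ _
      · exact le_rfl
    simp_rw [hterm]
    rw [← ENNReal.ofReal_sum_of_nonneg fun t _ => hnn t]
    refine ENNReal.ofReal_le_ofReal ?_
    have key := hatom δ hδ
    rw [Fintype.sum_prod_type]
    simp_rw [Fintype.sum_prod_type]
    exact key

/-- Projecting the lattice point with `i`-th coordinate `n` and transverse coordinates `y` to the torus
gives the layer site `ins_i(n, ȳ)`. -/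
theorem jointSpec_proj_insertNth {d' : ℕ} (N : ℕ) (i : Fin (d' + 1)) (n : ℕ) (y : Fin d' → ℤ) :
    Torus.proj N (i.insertNth (n : ℤ) y : Site (d' + 1)) = Torus.ins i (n : ZMod N) (Torus.proj N y) := by
  funext x
  exact Fin.succAboveCases i (by simp [Torus.ins]) (fun j => by simp [Torus.ins]) x

/-- **Stub 1 of the line `kl-band-positivity` (support, known): the JOINT SPECTRAL MEASURE in every
coordinate direction.** For each `i₀ : Fin 3` there is a finite positive measure `ρ` on `ℝ × ℝ²` with
`ρ ((0,1] × ℝ²)ᶜ = 0` and `⟨σ₀σ_x⟩⁺_{β_c(3)} = ∫ λ^{|x_{i₀}|} cos(k·x̌) dρ(λ,k)` for ALL `x ∈ ℤ³`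
(transfer matrix `0 ≤ T ≤ 1` commuting with the layer translations; Glimm–Jaffe 1987 §6.1,
Aizenman–Duminil-Copin 2021 Prop. 5.3 / App. Prop. 8.6; finite-torus joint spectral sums
`jointSpec_torusSum`, weak limit `jointSpec_limit`, `m*(β_c(3)) = 0`, reflection symmetry). -/
theorem stub_jointSpectralMeasure : Sig.stub_jointSpectralMeasure := by
  intro i₀
  classical
  have hβ : 0 < criticalBeta 3 := criticalBeta_pos_holds (d := 3) (by norm_num)
  have hm : spontaneousMagnetization 3 (criticalBeta 3) = 0 :=
    spontaneousMagnetization_criticalBeta_eq_zero_holds (d := 3) (by norm_num)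
  obtain ⟨B, hB0, hB⟩ := jointSpec_torusMeasure hβ 2
  have hex : ∀ j : ℕ, ∃ ν : Measure (ℝ × (Fin 2 → ℝ)), IsFiniteMeasure ν ∧
      ν (Set.Ici (0 : ℝ) ×ˢ Set.Icc (0 : Fin 2 → ℝ) (fun _ => 2 * Real.pi))ᶜ = 0 ∧
      (∀ g : ℝ × (Fin 2 → ℝ) → ℝ, Integrable g ν) ∧
      (∀ n : ℕ, n < j + 3 → ∀ y : Fin 2 → ℤ,
        ∫ p, p.1 ^ n * Real.cos (∑ j, p.2 j * (y j : ℝ)) ∂ν =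
          isingTorusTwoPoint 3 (j + 3) (criticalBeta 3) 0 0
            (Torus.ins i₀ (n : ZMod (j + 3)) (Torus.proj (j + 3) y))) ∧
      (∀ δ : ℝ, 0 ≤ δ → ν (Set.Icc 0 δ ×ˢ Set.univ) ≤ ENNReal.ofReal (B * δ ^ 2)) :=
    fun j => hB (j + 3) (by omega) i₀
  choose ν hfin hsupp hint hmom hzero using hex
  set u : ℕ → (Fin 2 → ℤ) → ℝ := fun n y => twoPointPlus 3 (criticalBeta 3) (i₀.insertNth (n : ℤ) y) with hu
  -- the torus test integrals converge to the plus-state two-point function (`m*(β_c) = 0`)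
  have hlim : ∀ n y, Tendsto (fun j => ∫ p, p.1 ^ n * Real.cos (∑ i, p.2 i * (y i : ℝ)) ∂(ν j)) atTop
      (𝓝 (u n y)) := by
    intro n y
    have hN : Tendsto (fun j : ℕ => j + 3) atTop atTop := tendsto_add_atTop_nat 3
    have key := tendsto_isingTorusTwoPoint_proj_of_magnetization_eq_zero (Nseq := fun j => j + 3) hβ.le hm hN
      (i₀.insertNth (n : ℤ) y)
    refine key.congr' ?_
    rw [EventuallyEq, eventually_atTop]
    refine ⟨n, fun j hj => ?_⟩
    rw [jointSpec_proj_insertNth, hmom j n (by omega) y]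
  have hle : ∀ j n, n ≤ j → ∫ p, p.1 ^ n ∂(ν j) ≤ 1 := by
    intro j n hnj
    have h := hmom j n (by omega) 0
    simp only [Pi.zero_apply, Int.cast_zero, mul_zero, Finset.sum_const_zero, Real.cos_zero, mul_one] at h
    rw [h]
    exact isingTorusTwoPoint_le_one _ _ _ _
  obtain ⟨μ, hμfin, hμsupp, hμ⟩ := jointSpec_limit u ν hfin hB0 hsupp (fun j n y => hint j _)
    (fun j n => hint j _) hle hlim hzero
  refine ⟨μ, hμfin, hμsupp, fun x => ?_⟩
  -- the representation at `x`: `x_{i₀} ≥ 0` directly, `x_{i₀} < 0` by the reflection symmetry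
  have hsymm : criticalTwoPoint 3 x = u (x i₀).natAbs (perp i₀ x) := by
    simp only [hu, criticalTwoPoint]
    rcases Int.natAbs_eq (x i₀) with h | h
    · congr 1
      funext j
      refine Fin.succAboveCases i₀ ?_ (fun j' => ?_) j
      · rw [Fin.insertNth_apply_same]
        exact h
      · rw [Fin.insertNth_apply_succAbove]
        rfl
    · rw [← twoPointPlus_reflection_invariant_holds (d := 3) hβ.le i₀ x]
      congr 1
      funext j
      refine Fin.succAboveCases i₀ ?_ (fun j' => ?_) j
      · rw [Function.update_self, Fin.insertNth_apply_same]
        omega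
      · rw [Function.update_of_ne (Fin.succAbove_ne i₀ j'), Fin.insertNth_apply_succAbove]
        rfl
  rw [hsymm, hμ]
  rfl

end Summit.CriticalPhenomena.Ising3DConformalLimit.Theorems.PerfectScreening.KlBand

end
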